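import Summits.Ventures.CertifiedArithmetic.LowPrec.SRTwoSum
import HarnessLib

/-!
# 2Sum under stochastic rounding, part 2: `|δa + δb| ≤ maxRat` and `E[s + t] = a + b` (file XXXVIII)

HONEST FRAMING: certified error envelopes and provably optimal rounding/accumulation schemes for
low-precision formats under stated cost models; every table by two implementations; no hardware or
vendor claims.

Continuation of file XXXVII (`SRTwoSum`: the operator `twoSumE`, the generic reduction
`twoSumE_add_of_inHull`, operation 3 exact `sub_mem_twoSum`, operations 4–5 in the hull).  Here,
for every minifloat format with at least one mantissa bit and ALL data (saturation included):

* `add_mem_valueSet_of_bottom`, `gap_le_half_maxRat`: the two spacing facts used;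
* `twoSum_corr_le`, **`twoSum_corr_abs_le`: `|δa + δb| ≤ maxRat` on every branch** (attained at
  `a = b = maxRat`) — operation 6 of 2Sum under SR never saturates
  [cite: BoldoGraillatMuller2017, Lemma 4.2: `|δa + δb| ≤ ulp(a + b)` for `p ≥ 4` without
  overflow; the saturating SR form is new];
* **`twoSumE_add`: `E[s + t] = a + b` for ALL `a, b`** — 2Sum under SR is an exactly unbiased
  compensated pair on the whole format (all thirteen named records, `manBits_pos_named`), although
  the sum alone is biased as soon as `a + b` leaves the hull and although `t` is not always the
  exact error (`twoSum_not_sure_E3M2`: `P(s + t = a + b) = 81/256`);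
* kernel witnesses on the literal FP4 / E3M2 tables: operation 2 saturating (`(−6, 1/2)`),
  operation 1 saturating (`(6, 6)`: `E s = 6`, `E[s + t] = 12`, the bound `maxRat` attained), and
  the E3M2 pair `(24, 7/4)`.
-/

namespace Summit.Ventures.CertifiedArithmetic.LowPrec.SR

open Literature.ComputerArithmetic.ConnollyHighamMary2021
open Literature.ComputerArithmetic.FloatingPoint
open Finset

section Formats

open Literature.ComputerArithmetic.FloatingPoint.MiniFloat

variable {φ : Format}

/-- `0 ∈ F` (also in file `SRRungR3Exact`, not imported here). -/
private theorem zero_mem (φ : Format) : (0 : ℚ) ∈ valueSet φ := by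
  simpa using toRat_mem_valueSet (MiniFloat.zero φ)

/-- An element of `F` lies in the hull (also in file `SRKahanFormats`, not imported here). -/
private theorem mem_inHull {F : Finset ℚ} {x : ℚ} (hx : x ∈ F) : InHull F x :=
  ⟨⟨x, hx, le_rfl⟩, ⟨x, hx, le_rfl⟩⟩

/-! ### Operation 6: `|δa + δb| ≤ maxRat` -/

/-- In the bottom binades (`maxScaled < 2^(m+1)`: the whole format is an integer grid) every sum
of two values inside the hull is a value. -/
theorem add_mem_valueSet_of_bottom (hsmall : φ.maxScaled < 2 ^ (φ.manBits + 1))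
    (a b : MiniFloat φ) (h : |a.toRat + b.toRat| ≤ φ.maxRat) :
    a.toRat + b.toRat ∈ valueSet φ := by
  have hq := φ.quantum_pos
  have hcN : a.toRat + b.toRat = ((a.toInt + b.toInt : ℤ) : ℚ) * φ.quantum := by
    unfold MiniFloat.toRat; push_cast; ring
  rw [hcN]
  refine intCast_mul_mem_valueSet (a := top φ) (by rw [scaledMag_top]; exact hsmall) ?_
  rw [scaledMag_top]
  have h1 : |((a.toInt + b.toInt : ℤ) : ℚ)| * φ.quantum
      ≤ (φ.maxScaled : ℚ) * φ.quantum := by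
    rw [hcN, abs_mul, abs_of_pos hq] at h; exact h
  have h2 : |((a.toInt + b.toInt : ℤ) : ℚ)| ≤ (φ.maxScaled : ℚ) :=
    le_of_mul_le_mul_right h1 hq
  have h3 : -(φ.maxScaled : ℚ) ≤ ((a.toInt + b.toInt : ℤ) : ℚ) ∧
      ((a.toInt + b.toInt : ℤ) : ℚ) ≤ (φ.maxScaled : ℚ) := abs_le.mp h2
  have h4 : -(φ.maxScaled : ℤ) ≤ a.toInt + b.toInt := by exact_mod_cast h3.1
  have h5 : a.toInt + b.toInt ≤ (φ.maxScaled : ℤ) := by exact_mod_cast h3.2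
  omega

/-- Spacing, formats with a mantissa bit, outside the bottom binades: every candidate gap on the
hull is at most `maxRat / 2`. -/
theorem gap_le_half_maxRat (hφ : 1 ≤ φ.manBits) (hbig : 2 ^ (φ.manBits + 1) ≤ φ.maxScaled)
    {c : ℚ} (hc : InHull (valueSet φ) c) :
    up (valueSet φ) c - dn (valueSet φ) c ≤ φ.maxRat / 2 := by
  have hq := φ.quantum_pos
  have hcM := (valueSet_inHull_iff φ c).mp hc
  have h1 : up (valueSet φ) c - dn (valueSet φ) c
      = roundUp (valueSet φ) c - roundDown (valueSet φ) c := by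
    unfold up dn; rw [clamp_eq_self hc]
  rw [h1]
  refine (valueSet_gap_le_max φ hc).trans (max_le ?_ ?_)
  · -- `quantum ≤ maxRat/2` since `2 ≤ maxScaled`
    have h2 : (2 : ℚ) ≤ φ.maxScaled := by
      have : 2 ≤ φ.maxScaled := le_trans (by
        calc 2 = 2 ^ 1 := by norm_num
          _ ≤ 2 ^ (φ.manBits + 1) := Nat.pow_le_pow_right (by norm_num) (by omega)) hbig
      exact_mod_cast this
    unfold Format.maxRat; nlinarith
  · -- `2u|c| ≤ maxRat/2` since `2u = 2^{-m} ≤ 1/2`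
    have h2 : 2 * φ.unitRoundoff ≤ 1 / 2 := by
      rw [Format.two_mul_unitRoundoff]
      refine one_div_le_one_div_of_le (by norm_num) ?_
      calc (2 : ℚ) = 2 ^ 1 := by norm_num
        _ ≤ 2 ^ φ.manBits := pow_le_pow_right₀ (by norm_num) hφ
    have h3 : 0 ≤ |c| := abs_nonneg c
    nlinarith

/-- One-sided form of `|δa + δb| ≤ maxRat`: `δa + δb ≤ maxRat` on every branch. -/
theorem twoSum_corr_le (hφ : 1 ≤ φ.manBits) (a b : MiniFloat φ) {s a' da db : ℚ}
    (hs : Faithful (valueSet φ) (a.toRat + b.toRat) s)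
    (ha' : Faithful (valueSet φ) (s - b.toRat) a')
    (hda : Faithful (valueSet φ) (a.toRat - a') da)
    (hdb : Faithful (valueSet φ) (b.toRat - (s - a')) db) : da + db ≤ φ.maxRat := by
  have hq := φ.quantum_pos
  have h0F := zero_mem φ
  have hMF := maxRat_mem_valueSet φ
  have hnMF := neg_maxRat_mem_valueSet φ
  have haM := abs_le.mp (abs_toRat_le_maxRat a)
  have hbM := abs_le.mp (abs_toRat_le_maxRat b)
  have hdaM := abs_le.mp (abs_le_maxRat_of_mem_valueSet hda.1)
  have hdbM := abs_le.mp (abs_le_maxRat_of_mem_valueSet hdb.1)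
  have hsM := abs_le.mp (abs_le_maxRat_of_mem_valueSet hs.1)
  have ha'F := ha'.1
  -- WLOG both corrections are positive
  rcases le_or_gt da 0 with hda0 | hda0
  · linarith
  rcases le_or_gt db 0 with hdb0 | hdb0
  · linarith
  have h4 : 0 < a.toRat - a' := by
    by_contra h; push Not at h
    have := hda.le_of_mem h0F h; linarith
  have h5 : 0 < b.toRat - (s - a') := by
    by_contra h; push Not at h
    have := hdb.le_of_mem h0F h; linarith
  -- the committed error of operation 1 dominates both pre-rounding values of operations 4, 5
  have he4 : a.toRat - a' < a.toRat + b.toRat - s := by linarith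
  have he5 : b.toRat - (s - a') < a.toRat + b.toRat - s := by linarith
  rcases le_or_gt (a.toRat + b.toRat) φ.maxRat with hcM | hcM
  · rcases lt_or_ge (a.toRat + b.toRat) (-φ.maxRat) with hcm | hcm
    · -- `a + b < −maxRat`: `s = −maxRat`, error `< 0` — contradiction
      have : s ≤ -φ.maxRat := hs.le_of_mem hnMF hcm.le
      linarith
    · -- `a + b` in the hull and not a value
      have hc : InHull (valueSet φ) (a.toRat + b.toRat) :=
        (valueSet_inHull_iff φ _).mpr (abs_le.mpr ⟨hcm, hcM⟩)
      have hcF : a.toRat + b.toRat ∉ valueSet φ := fun hcF => by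
        have := hs.eq_of_mem hcF; linarith
      rcases lt_or_ge φ.maxScaled (2 ^ (φ.manBits + 1)) with hsmall | hbig
      · exact absurd (add_mem_valueSet_of_bottom hsmall a b (abs_le.mpr ⟨hcm, hcM⟩)) hcF
      · -- error ≤ gap ≤ maxRat/2 and `maxRat/2 ∈ F`: both corrections are ≤ maxRat/2
        have hgap := (le_abs_self _).trans
          ((hs.abs_err_le_gap hc).trans (gap_le_half_maxRat hφ hbig hc))
        have hhalf : φ.maxRat / 2 ∈ valueSet φ := by
          have h := (half_mem_valueSet_or_lt (top φ)
            (by rw [toRat_top]; unfold Format.maxRat; positivity)).resolve_right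
            (by rw [scaledMag_top]; omega)
          rwa [toRat_top] at h
        have h6 : da ≤ φ.maxRat / 2 := hda.le_of_mem hhalf (by linarith)
        have h7 : db ≤ φ.maxRat / 2 := hdb.le_of_mem hhalf (by linarith)
        linarith
  · -- `a + b > maxRat`: `s = maxRat`, both data positive, `a'` the UPPER candidate of `maxRat − b`
    have hsE : s = φ.maxRat := le_antisymm hsM.2 (hs.ge_of_mem hMF hcM.le)
    rw [hsE] at h5 he4 he5 ha' hdb
    have hb0 : 0 < b.toRat := by linarith
    have ha0 : 0 < a.toRat := by linarith
    -- `maxRat − b ∉ F` (else `a' = maxRat − b`), so `2b < maxRat` by Sterbenz on `(maxRat, b)`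
    have hMb : φ.maxRat - b.toRat ∉ valueSet φ := fun h => by
      have := ha'.eq_of_mem h; linarith
    have h2b : 2 * b.toRat < φ.maxRat := by
      by_contra h; push Not at h
      apply hMb
      obtain ⟨d, hd⟩ := sterbenz (top φ) b (by rw [toRat_top]; linarith)
        (by rw [toRat_top]; linarith)
      exact mem_valueSet.mpr ⟨d, by rw [hd, toRat_top]⟩
    -- `a' > maxRat − b > maxRat/2`, `a' < a ≤ maxRat`: Sterbenz on `(a, a')`, operation 4 exact
    obtain ⟨a'₀, ha'₀⟩ := mem_valueSet.mp ha'F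
    have hexact : a.toRat - a' ∈ valueSet φ := by
      obtain ⟨d, hd⟩ := sterbenz a a'₀ (by rw [ha'₀]; linarith) (by rw [ha'₀]; linarith)
      exact mem_valueSet.mpr ⟨d, by rw [hd, ha'₀]⟩
    have h6 : da = a.toRat - a' := hda.eq_of_mem hexact
    -- operation 5's value `b − (maxRat − a') ≤ a'`, a value: `δb ≤ a'`
    have h7 : db ≤ a' := hdb.le_of_mem ha'F (by linarith)
    linarith

/-- **`|δa + δb| ≤ maxRat` ON EVERY BRANCH** (every format with a mantissa bit, all data,
saturation of operations 1–2 included): operation 6 of 2Sum under SR never saturates.  Equality is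
attained (`a = b = maxRat`: `s = maxRat`, `a' = 0`, `δa = maxRat`, `δb = 0`).
[cite: BoldoGraillatMuller2017, Lemma 4.2 (`|δa + δb| ≤ ulp(a + b)`, `p ≥ 4`, no overflow);
saturating SR model new] -/
theorem twoSum_corr_abs_le (hφ : 1 ≤ φ.manBits) (a b : MiniFloat φ) {s a' da db : ℚ}
    (hs : Faithful (valueSet φ) (a.toRat + b.toRat) s)
    (ha' : Faithful (valueSet φ) (s - b.toRat) a')
    (hda : Faithful (valueSet φ) (a.toRat - a') da)
    (hdb : Faithful (valueSet φ) (b.toRat - (s - a')) db) : |da + db| ≤ φ.maxRat := by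
  rw [abs_le]
  refine ⟨?_, twoSum_corr_le hφ a b hs ha' hda hdb⟩
  have hsym : ∀ y ∈ valueSet φ, -y ∈ valueSet φ := fun y hy => neg_mem_valueSet hy
  have hs' : Faithful (valueSet φ) (a.flipSign.toRat + b.flipSign.toRat) (-s) := by
    rw [toRat_flipSign, toRat_flipSign, ← neg_add]; exact hs.neg hsym
  have ha'' : Faithful (valueSet φ) (-s - b.flipSign.toRat) (-a') := by
    rw [toRat_flipSign, show -s - -b.toRat = -(s - b.toRat) by ring]; exact ha'.neg hsym
  have hda' : Faithful (valueSet φ) (a.flipSign.toRat - -a') (-da) := by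
    rw [toRat_flipSign, show -a.toRat - -a' = -(a.toRat - a') by ring]; exact hda.neg hsym
  have hdb' : Faithful (valueSet φ) (b.flipSign.toRat - (-s - -a')) (-db) := by
    rw [toRat_flipSign, show -b.toRat - (-s - -a') = -(b.toRat - (s - a')) by ring]
    exact hdb.neg hsym
  have h := twoSum_corr_le hφ a.flipSign b.flipSign hs' ha'' hda' hdb'
  linarith

/-! ### The theorem -/

/-- **2SUM UNDER STOCHASTIC ROUNDING IS EXACTLY UNBIASED — EVERY FORMAT, EVERY PAIR.**  For every
minifloat format with at least one mantissa bit (all thirteen named records) and ALL data `a, b`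
(no order hypothesis, saturation included): `E[s + t] = a + b`.  The first rounding alone is
biased exactly when `a + b` leaves the hull (`step_sum_unbiased_iff`, file XXXIV); the six-operation
compensated pair never is. [new] -/
theorem twoSumE_add (hφ : 1 ≤ φ.manBits) (a b : MiniFloat φ) :
    twoSumE (valueSet φ) a.toRat b.toRat (fun s t => s + t) = a.toRat + b.toRat := by
  refine twoSumE_add_of_inHull (valueSet_nonempty φ) _ _ fun s hs a' ha' => ?_
  have hA := sub_mem_twoSum a b hs ha'
  refine ⟨mem_inHull hA, twoSum_op4_inHull a b hs ha', fun b' hb' => ?_⟩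
  rw [hb'.eq_of_mem hA]
  exact ⟨twoSum_op5_inHull a b hs ha', fun da hda db hdb =>
    (valueSet_inHull_iff φ _).mpr (twoSum_corr_abs_le hφ a b hs ha' hda hdb)⟩

/-- The named formats have a mantissa bit (the hypothesis of `twoSumE_add`). -/
theorem manBits_pos_named :
    1 ≤ Format.E2M1.manBits ∧ 1 ≤ Format.E3M2.manBits ∧ 1 ≤ Format.E2M3.manBits ∧
    1 ≤ Format.E4M3.manBits ∧ 1 ≤ Format.E5M2.manBits ∧ 1 ≤ Format.Binary16.manBits ∧
    1 ≤ Format.BFloat16.manBits ∧ 1 ≤ Format.Binary32.manBits := by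
  refine ⟨?_, ?_, ?_, ?_, ?_, ?_, ?_, ?_⟩ <;> decide

/-- E4M3 (OCP FP8), for the record: `E[s + t] = a + b` for all `a, b : MiniFloat E4M3`. -/
theorem twoSumE_add_E4M3 (a b : MiniFloat Format.E4M3) :
    twoSumE (valueSet Format.E4M3) a.toRat b.toRat (fun s t => s + t) = a.toRat + b.toRat :=
  twoSumE_add (by decide) a b

/-! ### Kernel witnesses on the literal FP4 table -/

/-- OPERATION 2 SATURATES yet the pair is unbiased (E2M1, `a = −6`, `b = 1/2`): on the branch
`s = −6` the value `s − b = −13/2` leaves the hull (`a' = −6` surely there);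
`E[s + t] = −11/2`, and here `s + t = a + b` even surely. -/
theorem twoSum_op2_saturation_E2M1 :
    dn FP4.e2m1 ((-6 : ℚ) + 1 / 2) = -6 ∧ ¬ InHull FP4.e2m1 ((-6 : ℚ) - 1 / 2) ∧
    twoSumE FP4.e2m1 (-6) (1 / 2) (fun s t => s + t) = -11 / 2 ∧
    twoSumE FP4.e2m1 (-6) (1 / 2) (fun s t => if s + t = -11 / 2 then 1 else 0) = 1 := by
  refine ⟨by decide +kernel, by decide +kernel, by decide +kernel, by decide +kernel⟩

/-- OPERATION 1 SATURATES (E2M1, `a = b = 6`, `a + b = 12 > maxRat`): `E s = 6` (bias `−6`), but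
`a' = 0`, `b' = 6`, `δa = 6`, `δb = 0`, `t = 6` surely and `E[s + t] = 12 = a + b`; the bound
`|δa + δb| ≤ maxRat` of `twoSum_corr_abs_le` is attained. -/
theorem twoSum_op1_saturation_E2M1 :
    step FP4.e2m1 ((6 : ℚ) + 6) (fun s => s) = 6 ∧
    twoSumE FP4.e2m1 6 6 (fun _ t => if t = 6 then 1 else 0) = 1 ∧
    twoSumE FP4.e2m1 6 6 (fun s t => s + t) = 12 := by
  refine ⟨by decide +kernel, by decide +kernel, by decide +kernel⟩

/-- **E3M2: `t` is NOT always the exact error** — `a = 24`, `b = 7/4`: `P(s + t = a + b) = 81/256`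
(the minimum over all E3M2 pairs, cell certificate `certs/sr/gen7/eft/`), while
`E[s + t] = 103/4 = a + b` as the theorem says. -/
theorem twoSum_not_sure_E3M2 :
    twoSumE Formats.e3m2 24 (7 / 4) (fun s t => if s + t = 24 + 7 / 4 then 1 else 0) = 81 / 256 ∧
    twoSumE Formats.e3m2 24 (7 / 4) (fun s t => s + t) = 103 / 4 := by
  refine ⟨by decide +kernel, by decide +kernel⟩

end Formats

end Summit.Ventures.CertifiedArithmetic.LowPrec.SR
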